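import Summits.ValiantsHypothesis.ValiantsHypothesis.Theorems.DepthWindowHomCop
import Summits.ValiantsHypothesis.ValiantsHypothesis.Theorems.DepthWindowNewtonTrunc
import HarnessLib


/-!
# Route `DepthWindow`, g8 — the Newton gadget for ONE product gate (towards `HomRel k (2k)`,
LST Lemma 11 in the weighted gate-list model)

The normalisation step that makes the size of relative homogenisation independent of the
product fan-in.  For a product gate `Π_l u_l` (operands `us`, old gates `j < i` sitting at
positions `pos j` of the new block, constant coefficients `c j`), the GADGET is five layers:

* `B`: for every old gate `j < i` occurring in `us` with `c j ≠ 0` ("N-operand") the sum gate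
  `b_j = c_j⁻¹ · v_j - 1` (constant coefficient `0`), else the empty sum;
* `W`: the powers `b_j ^ jj`, `jj ≤ d` (product gates of fan-in `≤ d`);
* `P`: the power sums `p_jj = Σ_{N-operands} b_j ^ jj`;
* `M`: for every `k' ≤ d` and partition `μ ⊢ k'` the product of the "Z-operands" (variables,
  junk references, zero-constant old gates — at most `d` of them, else the gate is `0` modulo
  weight `> d`) with `Π_{j ∈ μ} p_j` (fan-in `≤ 2d`);
* `F`: one sum gate `γ · Σ_{k' ≤ d} Σ_μ c_{k',μ} · M_{k',μ}` with `γ` the product of the constants.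

By the truncated Newton identity (`DepthWindowNewtonTrunc.truncNewton`) the value of `F` agrees
with `Π_l v'_l` (the translated operands) modulo weight `> d`; every product gate of the gadget
has fan-in `≤ 2d`; the gadget has `i(d+2) + (d+1) + |pairs d| + 1` gates (`|pairs d| ≤ (d+1)2^d`),
independently of the fan-in; and every depth entry of the gadget is at most TWICE the old
product gate's entry (the `2` of `HomRel k (2k)`: `W` and `M` are two product layers).
This file (1/4): the gadget's definitions, its length and the fan-in of its product gates.
Sequel files: `…NewtonRefs` (references, values of layers B/W/P/M), `…NewtonValues` (value of
`F` via truncated Newton, depth entries), `…NewtonStep` (the packaged one-step lemma).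

[cite: LimayeSrinivasanTavenas2025, Lemma 11, Lemma 19, Lemma 20] [cite: Strassen1973, §3]
[cite: Burgisser2000, Def. 2.1]
-/

-- layout Summits/ValiantsHypothesis/ValiantsHypothesis forces the duplicated namespace component
set_option linter.dupNamespace false

namespace Summit.ValiantsHypothesis.ValiantsHypothesis.Theorems.DepthWindow

open MvPolynomial Literature.Computability.AlgebraicComplexity ArithCircuit
open Literature.Computability.AlgebraicComplexity.DepthReduction

/-! ### Small list helpers -/

/-- Reading a mapped `List.range` (total form). -/
theorem getD_map_range_ite {α : Type*} (f : ℕ → α) (dflt : α) (n r : ℕ) :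
    ((List.range n).map f).getD r dflt = if r < n then f r else dflt := by
  split_ifs with h
  · rw [List.getD_eq_getElem _ _ (by simpa using h), List.getElem_map, List.getElem_range]
  · exact List.getD_eq_default _ _ (by simpa using Nat.le_of_not_lt h)

/-- A `List.sum` over a mapped list as a `Finset.sum` over `Fin length`. -/
theorem sum_map_eq_sum_get {M : Type*} [AddCommMonoid M] {α : Type*} (us : List α) (g : α → M) :
    (us.map g).sum = ∑ l : Fin us.length, g (us.get l) := by
  rw [← List.sum_ofFn]
  congr 1
  conv_lhs => rw [← List.ofFn_get us]
  rw [List.map_ofFn]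
  rfl

/-- Products with factors `1` off a filter. -/
theorem prod_map_ite_eq_prod_filter {M : Type*} [CommMonoid M] {α : Type*} (l : List α)
    (p : α → Bool) (f : α → M) :
    (l.map fun a => if p a then f a else 1).prod = ((l.filter p).map f).prod := by
  induction l with
  | nil => rfl
  | cons a l ih =>
      rw [List.map_cons, List.prod_cons, ih, List.filter_cons]
      cases p a <;> simp

/-- Mapping through `getD` over the index range. -/
theorem map_comp_getD_range {α β : Type*} (l : List α) (dflt : α) (g : α → β) :
    (List.range l.length).map (fun r => g (l.getD r dflt)) = l.map g := by
  rw [show (fun r => g (l.getD r dflt)) = g ∘ (fun r => l.getD r dflt) from rfl,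
    ← List.map_map, map_getD_range]

/-- `List.range`-indexed maps agreeing with a map over the list. -/
theorem map_range_eq_map {α β : Type*} (l : List α) (dflt : α) (F : ℕ → β) (g : α → β)
    (h : ∀ r < l.length, F r = g (l.getD r dflt)) : (List.range l.length).map F = l.map g := by
  rw [← map_comp_getD_range l dflt g]
  exact List.map_congr_left fun r hr => h r (List.mem_range.mp hr)

section EvalUnfold

variable {k : Type*} [CommSemiring k] {τ : Type*}

/-- Unfolding the value of a sum gate. -/
theorem eval_sum (V : List (MvPolynomial τ k)) (args : List (k × Operand k τ)) :
    (Gate.sum args).eval V = (args.map fun a => a.1 • a.2.eval V).sum := rfl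

/-- Unfolding the value of a product gate. -/
theorem eval_prod (V : List (MvPolynomial τ k)) (args : List (Operand k τ)) :
    (Gate.prod args).eval V = (args.map fun u => u.eval V).prod := rfl

end EvalUnfold

/-! ### The pairs `(k', μ ⊢ k')`, `k' ≤ d` -/

/-- The list of pairs `(k', μ)` with `k' ≤ d` and `μ` a partition of `k'`. -/
noncomputable def pairs (d : ℕ) : List (Σ kk : ℕ, kk.Partition) :=
  (List.range (d + 1)).flatMap fun kk =>
    (Finset.univ : Finset kk.Partition).toList.map fun μ => ⟨kk, μ⟩

/-- Members of `pairs d` have first component `≤ d`. -/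
theorem fst_le_of_mem_pairs {d : ℕ} {pr : Σ kk : ℕ, kk.Partition} (h : pr ∈ pairs d) : pr.1 ≤ d := by
  simp only [pairs, List.mem_flatMap, List.mem_range, List.mem_map, Finset.mem_toList,
    Finset.mem_univ, true_and] at h
  obtain ⟨kk, hkk, μ, rfl⟩ := h
  exact Nat.lt_succ_iff.mp hkk

/-- `|pairs d| ≤ (d + 1) · 2 ^ d`. -/
theorem length_pairs_le (d : ℕ) : (pairs d).length ≤ (d + 1) * 2 ^ d := by
  have aux : ∀ n, n ≤ d + 1 →
      ((List.range n).flatMap fun kk =>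
        (Finset.univ : Finset kk.Partition).toList.map fun μ => (⟨kk, μ⟩ : Σ kk : ℕ, kk.Partition)).length
        ≤ n * 2 ^ d := by
    intro n
    induction n with
    | zero => intro _; simp
    | succ n ih =>
        intro hn
        rw [List.range_succ, List.flatMap_append, List.length_append, Nat.succ_mul]
        refine Nat.add_le_add (ih (by omega)) ?_
        simp only [List.flatMap_cons, List.flatMap_nil, List.append_nil, List.length_map,
          Finset.length_toList, Finset.card_univ]
        exact (card_partition_le n).trans (Nat.pow_le_pow_right (by norm_num) (by omega))
  exact aux (d + 1) le_rfl

/-- Summing over `pairs d` is the double sum over `k' ≤ d` and `μ ⊢ k'`. -/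
theorem sum_map_pairs {M : Type*} [AddCommMonoid M] (d : ℕ) (g : (Σ kk : ℕ, kk.Partition) → M) :
    ((pairs d).map g).sum = ∑ kk ∈ Finset.range (d + 1), ∑ μ : kk.Partition, g ⟨kk, μ⟩ := by
  rw [pairs, List.map_flatMap, sum_flatMap, sum_range_eq_list_sum]
  congr 1
  refine List.map_congr_left fun kk _ => ?_
  rw [List.map_map, Finset.sum_map_toList]
  rfl

/-! ### The gadget -/

section Gadget

variable {k : Type*} [Field k] {τ : Type*}

/-- Translation of an operand of the old block into the new block: old gate `j < i` sits at
position `pos j`; out-of-range references are the junk value `0`. -/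
def top (i : ℕ) (pos : ℕ → ℕ) : Operand k τ → Operand k τ
  | .var t => .var t
  | .const a => .const a
  | .gate j => if j < i then .gate (pos j) else .const 0

variable (i : ℕ) (pos : ℕ → ℕ) (c : ℕ → k) (us : List (Operand k τ)) (d L : ℕ)

open Classical in
/-- Layer `B`, gate `j`: `b_j = c_j⁻¹ · v_j - 1` for an N-index (`j < i`, `c j ≠ 0`, `gate j`
occurs among the operands), else the empty sum. [cite: LimayeSrinivasanTavenas2025, Lemma 11] -/
noncomputable def gateB (j : ℕ) : Gate k τ :=
  if j < i ∧ c j ≠ 0 ∧ Operand.gate j ∈ us then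
    Gate.sum [((c j)⁻¹, .gate (pos j)), (-1, .const 1)]
  else Gate.sum []

/-- Layer `B` (one gate per old index `j < i`). -/
noncomputable def layerB : List (Gate k τ) := (List.range i).map (gateB i pos c us)

/-- Layer `W`: gate `(d + 1) * j + jj` is the power `b_j ^ jj` (`jj ≤ d`), a product gate of
fan-in `jj ≤ d` reading layer `B` at `L + j`. -/
def layerW : List (Gate k τ) :=
  (List.range (i * (d + 1))).map fun r =>
    Gate.prod (List.replicate (r % (d + 1)) (.gate (L + r / (d + 1))))

open Classical in
/-- The (coefficient, operand) pair of operand `u` in the power sum `p_jj`: `(1, W_{j,jj})` for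
an N-operand `gate j`, else `(0, 0)`. -/
noncomputable def argP (jj : ℕ) : Operand k τ → k × Operand k τ
  | .gate j => if j < i ∧ c j ≠ 0 then (1, .gate (L + i + ((d + 1) * j + jj))) else (0, .const 0)
  | _ => (0, .const 0)

/-- Layer `P`: the power sums `p_jj`, `jj ≤ d`. -/
noncomputable def layerP : List (Gate k τ) :=
  (List.range (d + 1)).map fun jj => Gate.sum (us.map (argP i c d L jj))

open Classical in
/-- Z-operands: variables, and gate references that are NOT N-indices (junk references and
zero-constant old gates); constants are neither. -/
noncomputable def isZb : Operand k τ → Bool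
  | .var _ => true
  | .const _ => false
  | .gate j => !decide (j < i ∧ c j ≠ 0)

/-- The translated Z-operands of the product gate. -/
noncomputable def zops : List (Operand k τ) := (us.filter (isZb i c)).map (top i pos)

/-- The Z-operands kept in layer `M`: all of them if there are at most `d`, else none (then the
product is `0` modulo weight `> d` and gate `F` is the empty sum). -/
noncomputable def zkeep : List (Operand k τ) :=
  if (zops i pos c us).length ≤ d then zops i pos c us else []

/-- Layer `M`: for each pair `(k', μ)` the product of the kept Z-operands with `Π_{j ∈ μ} p_j`
(fan-in `≤ 2d`). -/
noncomputable def layerM : List (Gate k τ) :=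
  (pairs d).map fun pr =>
    Gate.prod (zkeep i pos c us d ++ pr.2.parts.toList.map fun j => .gate (L + i + i * (d + 1) + j))

open Classical in
/-- The constant contributed by an operand to `γ`: the constant itself, `c j` for an N-operand,
`1` otherwise. -/
noncomputable def constPart : Operand k τ → k
  | .var _ => 1
  | .const a => a
  | .gate j => if j < i ∧ c j ≠ 0 then c j else 1

variable [Algebra ℚ k] (cc : (kk : ℕ) → kk.Partition → ℚ)

/-- The default pair (only for `getD` bookkeeping). -/
noncomputable def dfltPair : Σ kk : ℕ, kk.Partition := ⟨0, Nat.Partition.indiscrete 0⟩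

/-- The coefficient of the `r`-th `M` gate in gate `F`: `γ · c_{k',μ}`. -/
noncomputable def coefF (r : ℕ) : k :=
  (us.map (constPart i c)).prod *
    algebraMap ℚ k (cc ((pairs d).getD r dfltPair).1 ((pairs d).getD r dfltPair).2)

/-- Gate `F`: `Σ_r (γ · c_{k',μ}) · M_r`, or the empty sum when more than `d` Z-operands occur.
[cite: LimayeSrinivasanTavenas2025, Lemma 11] -/
noncomputable def gateF : Gate k τ :=
  if (zops i pos c us).length ≤ d then
    Gate.sum ((List.range (pairs d).length).map fun r =>
      (coefF i c us d cc r, .gate (L + i + i * (d + 1) + (d + 1) + r)))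
  else Gate.sum []

/-- The whole gadget replacing the product gate. -/
noncomputable def gadget : List (Gate k τ) :=
  layerB i pos c us ++ layerW i d L ++ layerP i c us d L ++ layerM i pos c us d L ++
    [gateF i pos c us d L cc]

/-! ### Lengths -/

omit [Algebra ℚ k] in
/-- `|B| = i`. -/
theorem length_layerB : (layerB i pos c us).length = i := by simp [layerB]

omit [Field k] [Algebra ℚ k] in
/-- `|W| = i (d + 1)`. -/
theorem length_layerW : (layerW i d L : List (Gate k τ)).length = i * (d + 1) := by simp [layerW]

omit [Algebra ℚ k] in
/-- `|P| = d + 1`. -/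
theorem length_layerP : (layerP i c us d L).length = d + 1 := by simp [layerP]

omit [Algebra ℚ k] in
/-- `|M| = |pairs d|`. -/
theorem length_layerM : (layerM i pos c us d L).length = (pairs d).length := by simp [layerM]

/-- The gadget has `i + i(d+1) + (d+1) + |pairs d| + 1` gates — independently of the fan-in. -/
theorem length_gadget : (gadget i pos c us d L cc).length =
    i + i * (d + 1) + (d + 1) + (pairs d).length + 1 := by
  simp only [gadget, List.length_append, length_layerB, length_layerW, length_layerP,
    length_layerM, List.length_singleton]

/-- The gadget size bound `≤ (i + d + 2)² · 2^(d+2)`. -/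
theorem length_gadget_le : (gadget i pos c us d L cc).length ≤ (i + d + 2) ^ 2 * 2 ^ (d + 2) := by
  rw [length_gadget]
  have hp := length_pairs_le d
  have h1 : i + i * (d + 1) ≤ (i + d + 2) ^ 2 := by nlinarith
  have h2 : (d + 1) + 1 ≤ (i + d + 2) := by omega
  have h3 : (d + 1) * 2 ^ d ≤ (i + d + 2) * 2 ^ d := Nat.mul_le_mul_right _ (by omega)
  have hS : 1 ≤ i + d + 2 := by omega
  have h2d : 1 ≤ 2 ^ d := Nat.one_le_two_pow
  calc i + i * (d + 1) + (d + 1) + (pairs d).length + 1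
      ≤ (i + d + 2) ^ 2 + (i + d + 2) + (i + d + 2) * 2 ^ d := by omega
    _ ≤ (i + d + 2) ^ 2 * 2 ^ d + (i + d + 2) ^ 2 * 2 ^ d + (i + d + 2) ^ 2 * 2 ^ d := by
        refine Nat.add_le_add (Nat.add_le_add ?_ ?_) ?_
        · exact Nat.le_mul_of_pos_right _ (by omega)
        · calc (i + d + 2) = (i + d + 2) * 1 * 1 := by ring
            _ ≤ (i + d + 2) * (i + d + 2) * 2 ^ d :=
                Nat.mul_le_mul (Nat.mul_le_mul_left _ hS) h2d
            _ = (i + d + 2) ^ 2 * 2 ^ d := by ring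
        · calc (i + d + 2) * 2 ^ d = (i + d + 2) * 1 * 2 ^ d := by ring
            _ ≤ (i + d + 2) * (i + d + 2) * 2 ^ d :=
                Nat.mul_le_mul_right _ (Nat.mul_le_mul_left _ hS)
            _ = (i + d + 2) ^ 2 * 2 ^ d := by ring
    _ = 3 * ((i + d + 2) ^ 2 * 2 ^ d) := by ring
    _ ≤ 4 * ((i + d + 2) ^ 2 * 2 ^ d) := Nat.mul_le_mul_right _ (by norm_num)
    _ = (i + d + 2) ^ 2 * 2 ^ (d + 2) := by ring

/-! ### Fan-in of the product gates of the gadget -/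

omit [Algebra ℚ k] in
/-- The kept Z-operands are at most `d`. -/
theorem length_zkeep_le : (zkeep i pos c us d).length ≤ d := by
  unfold zkeep; split_ifs with h
  · exact h
  · exact Nat.zero_le _

/-- **Every product gate of the gadget has fan-in `≤ 2d`.** -/
theorem fanIn_gadget : ∀ vs : List (Operand k τ), Gate.prod vs ∈ gadget i pos c us d L cc →
    vs.length ≤ 2 * d := by
  intro vs hvs
  simp only [gadget, List.mem_append, List.mem_singleton] at hvs
  rcases hvs with (((hB | hW) | hP) | hM) | hF
  · simp only [layerB, List.mem_map, List.mem_range] at hB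
    obtain ⟨j, _, hj⟩ := hB
    unfold gateB at hj; split_ifs at hj
  · simp only [layerW, List.mem_map, List.mem_range] at hW
    obtain ⟨r, _, hr⟩ := hW
    have h := (Gate.prod.injEq _ _).mp hr
    rw [← h, List.length_replicate]
    have : r % (d + 1) < d + 1 := Nat.mod_lt r (by omega)
    omega
  · simp only [layerP, List.mem_map, List.mem_range] at hP
    obtain ⟨jj, _, hjj⟩ := hP
    exact absurd hjj (by simp)
  · simp only [layerM, List.mem_map] at hM
    obtain ⟨pr, hpr, hM⟩ := hM
    have h := (Gate.prod.injEq _ _).mp hM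
    rw [← h, List.length_append, List.length_map, Multiset.length_toList]
    have h1 := length_zkeep_le i pos c us d
    have h2 := (parts_card_le pr.2).trans (fst_le_of_mem_pairs hpr)
    omega
  · unfold gateF at hF; split_ifs at hF

end Gadget

end Summit.ValiantsHypothesis.ValiantsHypothesis.Theorems.DepthWindow
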